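import Literature.RepresentationTheory.FiniteGroups.CosetKernelModule
import Literature.NumberTheory.NumberFields.ClassGroupFixedHomDescent
import Literature.NumberTheory.NumberFields.ClassGroupPTorsionFixedFieldDescent
import Literature.GroupTheory.FiniteAbelian.HomCounts
import HarnessLib

/-!
# Equal `p`-ranks of `Cl(K^H)` and `Cl(K^{H′})` ⟺ no equivariant character `Cl(K) → C(G; H ≤ H′)`
# (the layer-free half of the rank-equality transfer door; Frobenius reciprocity + Neukirch III (1.6))

Topic `NumberTheory/NumberFields` (namespace = path).  THEOREM-ONLY file (no definition, no named fact, no `sorry`),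
written by the prover seat `bsd-potss-k8t-c4` g25 (cell `bsd-potss`; `--supports` stmt-BirchSwinnertonDyer-19982, the U₀ node
`TameUpperDefectRankZero` of route K8-t′; closes nothing; BSD / Conjecture A for no curve).

`K/F` finite Galois, `G = Gal(K/F)`, `H ≤ H′ ≤ G`, `p` a prime with `p ∤ #H′`, `C = cosetKernel H H′ (ℤ/p)` the coset-kernel
`G`-module of `Literature/RepresentationTheory/FiniteGroups/CosetKernelModule.lean`, `G` acting on `Cl(K)` through
`σ ↦ ClassGroup.mulEquiv (AmbiguousClass.intAut σ)`.

* `equivariantHom_cosetKernel_eq_zero_of_natCard_torsion_eq` — **if `#Cl(K^H)[p] = #Cl(K^{H′})[p]` then every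
  `G`-equivariant additive `μ : Cl(K) → C` is zero**: by `ClassGroupFixedHomDescent` + `|Hom(·, ℤ/p)| = |·[p]|`
  (`GroupTheory/FiniteAbelian/HomCounts`) the `H`- and the `H′`-invariant `𝔽_p`-characters of `Cl(K)` are equinumerous, so they
  coincide, and `CosetKernelModule.equivariantHom_eq_zero_of_forall_invariant` applies.
* `natCard_torsion_classGroup_fixedField_eq_of_forall_equivariantHom_cosetKernel_eq_zero` — **conversely, if every
  `G`-equivariant additive `Cl(K) → C` is zero then `#Cl(K^H)[p] = #Cl(K^{H′})[p]`**
  (`CosetKernelModule.invariant_of_forall_equivariantHom_eq_zero`, then the same counts).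

These are hypothesis (c2*) and the read-out of the conclusion of the tree's equivariant Iwasawa lemma
(`EquivariantIwasawaLemma.equivariantHom_classGroup_eq_zero_layer_compositum_tower_of_totallyRamified`, with `V = C`) in the
LEAF-RANK currency of the cell's μ-road census: for `L/ℚ` Galois with one prime above `p`, equal `p`-ranks of `Cl(L^H)` and
`Cl(L^{H′})` persist along the cyclotomic tower (assembly with the layers NOT in this file).

## References

* J. Neukirch, *Algebraic Number Theory* (1999), Ch. III §1 Prop. (1.6) (ii), (iv). [NeukirchANT1999]
* J.-P. Serre, *Linear Representations of Finite Groups*, GTM 42, §7.2 Thm. 13 (Frobenius reciprocity). [SerreLinearRepresentations1977]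
-/

noncomputable section

open NumberField IntermediateField
open Literature.RepresentationTheory.FiniteGroups Literature.GroupTheory.FiniteAbelian

namespace Literature.NumberTheory.NumberFields

variable (F K : Type) [Field F] [NumberField F] [Field K] [NumberField K] [Algebra F K] [IsGalois F K]

/-! ### §1 Counting the invariant `𝔽_p`-characters of `Cl(K)` -/

/-- `p • v = 0` in `ℤ/p`. [folklore] -/
private theorem zmod_nsmul_eq_zero (p : ℕ) (v : ZMod p) : p • v = 0 := by
  rw [nsmul_eq_mul, ZMod.natCast_self, zero_mul]

/-- `#Hom(Cl(E), ℤ/p) = #Cl(E)[p]` for a number field `E` (`|Hom(G, ℤ/n)| = |G[n]|`, tree `natCard_addMonoidHom_zmod_right`).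
[cite: NeukirchANT1999, Ch. III §1 Prop. (1.6) (ii)] -/
private theorem natCard_addMonoidHom_classGroup_zmod (E : Type) [Field E] [NumberField E] (p : ℕ) [NeZero p] :
    Nat.card (Additive (ClassGroup (𝓞 E)) →+ ZMod p) = Nat.card {d : ClassGroup (𝓞 E) // d ^ p = 1} := by
  rw [natCard_addMonoidHom_zmod_right]
  refine Nat.card_congr ⟨fun x => ⟨Additive.toMul x.1, ?_⟩, fun d => ⟨Additive.ofMul d.1, ?_⟩, fun _ => rfl, fun _ => rfl⟩
  · have h := AddSubgroup.torsionBy.nsmul_iff.mp x.2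
    rwa [← ofMul_toMul x.1, ← ofMul_pow, ofMul_eq_zero] at h
  · exact AddSubgroup.torsionBy.nsmul_iff.mpr (by rw [← ofMul_pow, d.2, ofMul_one])

/-- `#{S-invariant additive ν : Cl(K) → ℤ/p} = #Cl(K^S)[p]` for `S ≤ Gal(K/F)` with `p ∤ #S`
(tree `natCard_fixed_addMonoidHom_classGroup_eq` + the previous count). [cite: NeukirchANT1999, Ch. III §1 Prop. (1.6) (ii), (iv)] -/
private theorem natCard_invariant_eq (S : Subgroup (K ≃ₐ[F] K)) [Fintype S] {p : ℕ} [Fact p.Prime]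
    (hpS : ¬ p ∣ Fintype.card S) :
    Nat.card {ν : Additive (ClassGroup (𝓞 K)) →+ ZMod p // ∀ h ∈ S, ∀ c : ClassGroup (𝓞 K),
        ν (Additive.ofMul (ClassGroup.mulEquiv (AmbiguousClass.intAut h) c)) = ν (Additive.ofMul c)} =
      Nat.card {d : ClassGroup (𝓞 ↥(fixedField S)) // d ^ p = 1} := by
  haveI : NeZero p := ⟨(Fact.out : p.Prime).ne_zero⟩
  rw [natCard_fixed_addMonoidHom_classGroup_eq F K S (zmod_nsmul_eq_zero p)
    ((Nat.Prime.coprime_iff_not_dvd Fact.out).mpr hpS), natCard_addMonoidHom_classGroup_zmod]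

omit [NumberField F] [NumberField K] [IsGalois F K] in
/-- `p ∤ #S` makes `#S` injective on `ℤ/p`. [folklore] -/
private theorem zmod_card_nsmul_injective (S : Subgroup (K ≃ₐ[F] K)) [Fintype S] {p : ℕ} [Fact p.Prime]
    (hpS : ¬ p ∣ Fintype.card S) (r : ZMod p) (hr : Fintype.card S • r = 0) : r = 0 := by
  rw [nsmul_eq_mul] at hr
  have hne : ((Fintype.card S : ℕ) : ZMod p) ≠ 0 := by
    rw [Ne, ZMod.natCast_eq_zero_iff]
    exact hpS
  exact (mul_eq_zero.mp hr).resolve_left hne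

/-! ### §2 Rank equality ⟹ (c2*) -/

/-- **Equal `p`-torsion counts of `Cl(K^H)` and `Cl(K^{H′})` kill every `G`-equivariant additive map `Cl(K) → C(G; H ≤ H′)`**
(`K/F` Galois, `H ≤ H′ ≤ Gal(K/F)`, `p ∤ #H′`, `C = cosetKernel H H′ (ℤ/p)`): the `H′`-invariant `𝔽_p`-characters of `Cl(K)`
form a subset of the `H`-invariant ones of the same (finite) size `#Cl(K^{H′})[p] = #Cl(K^H)[p]`, so every `H`-invariant
character is `H′`-invariant, and `CosetKernelModule.equivariantHom_eq_zero_of_forall_invariant` applies.  This is hypothesis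
(c2*) of the tree's equivariant Iwasawa lemma for `V = C`. [cite: NeukirchANT1999, Ch. III §1 Prop. (1.6) (ii), (iv)]
[cite: SerreLinearRepresentations1977, §7.2 Thm. 13 (Frobenius reciprocity)] -/
theorem equivariantHom_cosetKernel_eq_zero_of_natCard_torsion_eq (H H' : Subgroup (K ≃ₐ[F] K)) (hHH' : H ≤ H')
    [Fintype H] [Fintype H'] {p : ℕ} [Fact p.Prime] (hpH' : ¬ p ∣ Fintype.card H')
    (hrank : Nat.card {d : ClassGroup (𝓞 ↥(fixedField H)) // d ^ p = 1} =
      Nat.card {d : ClassGroup (𝓞 ↥(fixedField H')) // d ^ p = 1})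
    (μ : Additive (ClassGroup (𝓞 K)) →+ cosetKernel H H' (ZMod p))
    (hμ : ∀ (σ : K ≃ₐ[F] K) (c : ClassGroup (𝓞 K)),
      μ (Additive.ofMul (ClassGroup.mulEquiv (AmbiguousClass.intAut σ) c)) = σ • μ (Additive.ofMul c)) :
    μ = 0 := by
  classical
  -- the Galois action on `Additive (Cl K)` as a monoid homomorphism into `End`
  let ρ : (K ≃ₐ[F] K) →* AddMonoid.End (Additive (ClassGroup (𝓞 K))) :=
    { toFun := fun σ => (ClassGroup.mulEquiv (AmbiguousClass.intAut σ)).toMonoidHom.toAdditive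
      map_one' := AddMonoidHom.ext fun a => by
        change Additive.ofMul (ClassGroup.mulEquiv (AmbiguousClass.intAut (1 : K ≃ₐ[F] K)) (Additive.toMul a)) = a
        rw [AmbiguousClass.mulEquiv_intAut_one, MulEquiv.refl_apply, ofMul_toMul]
      map_mul' := fun σ τ => AddMonoidHom.ext fun a => by
        change Additive.ofMul (ClassGroup.mulEquiv (AmbiguousClass.intAut (σ * τ)) (Additive.toMul a)) =
          Additive.ofMul (ClassGroup.mulEquiv (AmbiguousClass.intAut σ)
            (Additive.toMul (Additive.ofMul (ClassGroup.mulEquiv (AmbiguousClass.intAut τ) (Additive.toMul a)))))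
        rw [AmbiguousClass.mulEquiv_intAut_mul, MulEquiv.trans_apply, toMul_ofMul] }
  have hρ : ∀ (σ : K ≃ₐ[F] K) (a : Additive (ClassGroup (𝓞 K))),
      ρ σ a = Additive.ofMul (ClassGroup.mulEquiv (AmbiguousClass.intAut σ) (Additive.toMul a)) := fun _ _ => rfl
  have hpH : ¬ p ∣ Fintype.card H := fun h =>
    hpH' (h.trans (by simpa [← Nat.card_eq_fintype_card] using Subgroup.card_dvd_of_le hHH'))
  -- the `H`- and `H′`-invariant characters are equinumerous
  have hcard : Nat.card {ν : Additive (ClassGroup (𝓞 K)) →+ ZMod p // ∀ h ∈ H, ∀ c : ClassGroup (𝓞 K),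
        ν (Additive.ofMul (ClassGroup.mulEquiv (AmbiguousClass.intAut h) c)) = ν (Additive.ofMul c)} =
      Nat.card {ν : Additive (ClassGroup (𝓞 K)) →+ ZMod p // ∀ h ∈ H', ∀ c : ClassGroup (𝓞 K),
        ν (Additive.ofMul (ClassGroup.mulEquiv (AmbiguousClass.intAut h) c)) = ν (Additive.ofMul c)} := by
    rw [natCard_invariant_eq F K H hpH, natCard_invariant_eq F K H' hpH', hrank]
  -- hence every `H`-invariant character is `H′`-invariant
  let ι : {ν : Additive (ClassGroup (𝓞 K)) →+ ZMod p // ∀ h ∈ H', ∀ c : ClassGroup (𝓞 K),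
        ν (Additive.ofMul (ClassGroup.mulEquiv (AmbiguousClass.intAut h) c)) = ν (Additive.ofMul c)} →
      {ν : Additive (ClassGroup (𝓞 K)) →+ ZMod p // ∀ h ∈ H, ∀ c : ClassGroup (𝓞 K),
        ν (Additive.ofMul (ClassGroup.mulEquiv (AmbiguousClass.intAut h) c)) = ν (Additive.ofMul c)} :=
    fun ν => ⟨ν.1, fun h hh c => ν.2 h (hHH' hh) c⟩
  haveI : Finite (Additive (ClassGroup (𝓞 K))) := Finite.of_equiv _ Additive.ofMul
  haveI : Finite (Additive (ClassGroup (𝓞 K)) →+ ZMod p) := Finite.of_injective _ DFunLike.coe_injective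
  have hι : Function.Injective ι := fun ν ν' h => Subtype.ext (by simpa [ι] using congrArg Subtype.val h)
  have hιs : Function.Surjective ι :=
    (Function.Injective.bijective_of_nat_card_le hι hcard.le).2
  have hfix : ∀ ν : Additive (ClassGroup (𝓞 K)) →+ ZMod p,
      (∀ h ∈ H, ∀ a, ν (ρ h a) = ν a) → ∀ h' ∈ H', ∀ a, ν (ρ h' a) = ν a := by
    intro ν hν h' hh' a
    obtain ⟨⟨ν', hν'⟩, hνν'⟩ := hιs ⟨ν, fun h hh c => by simpa [hρ] using hν h hh (Additive.ofMul c)⟩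
    have heq : ν' = ν := congrArg Subtype.val hνν'
    rw [hρ, ← heq]
    exact hν' h' hh' (Additive.toMul a)
  refine equivariantHom_eq_zero_of_forall_invariant H H' (ZMod p) (ρ)
    (zmod_card_nsmul_injective F K H' hpH') hfix μ fun σ a => ?_
  rw [hρ, hμ, ofMul_toMul]

/-! ### §3 (c2*)-type vanishing ⟹ rank equality -/

/-- **If every `G`-equivariant additive `Cl(K) → C(G; H ≤ H′)` vanishes then `#Cl(K^H)[p] = #Cl(K^{H′})[p]`**
(`K/F` Galois, `H ≤ H′`, `p ∤ #H′`): by `CosetKernelModule.invariant_of_forall_equivariantHom_eq_zero` every `H`-invariant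
`𝔽_p`-character of `Cl(K)` is `H′`-invariant, so the two sets of invariant characters coincide, and their sizes are the two
`p`-torsion counts (`ClassGroupFixedHomDescent`, `HomCounts`).  This reads the conclusion of the tree's equivariant Iwasawa lemma
(`V = C`) as equality of leaf `p`-ranks. [cite: NeukirchANT1999, Ch. III §1 Prop. (1.6) (ii), (iv)]
[cite: SerreLinearRepresentations1977, §7.2 Thm. 13 (Frobenius reciprocity)] -/
theorem natCard_torsion_classGroup_fixedField_eq_of_forall_equivariantHom_cosetKernel_eq_zero
    (H H' : Subgroup (K ≃ₐ[F] K)) (hHH' : H ≤ H') [Fintype H] [Fintype H'] {p : ℕ} [Fact p.Prime]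
    (hpH' : ¬ p ∣ Fintype.card H')
    (hvan : ∀ μ : Additive (ClassGroup (𝓞 K)) →+ cosetKernel H H' (ZMod p),
      (∀ (σ : K ≃ₐ[F] K) (c : ClassGroup (𝓞 K)),
        μ (Additive.ofMul (ClassGroup.mulEquiv (AmbiguousClass.intAut σ) c)) = σ • μ (Additive.ofMul c)) → μ = 0) :
    Nat.card {d : ClassGroup (𝓞 ↥(fixedField H)) // d ^ p = 1} =
      Nat.card {d : ClassGroup (𝓞 ↥(fixedField H')) // d ^ p = 1} := by
  classical
  -- the Galois action on `Additive (Cl K)` as a monoid homomorphism into `End`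
  let ρ : (K ≃ₐ[F] K) →* AddMonoid.End (Additive (ClassGroup (𝓞 K))) :=
    { toFun := fun σ => (ClassGroup.mulEquiv (AmbiguousClass.intAut σ)).toMonoidHom.toAdditive
      map_one' := AddMonoidHom.ext fun a => by
        change Additive.ofMul (ClassGroup.mulEquiv (AmbiguousClass.intAut (1 : K ≃ₐ[F] K)) (Additive.toMul a)) = a
        rw [AmbiguousClass.mulEquiv_intAut_one, MulEquiv.refl_apply, ofMul_toMul]
      map_mul' := fun σ τ => AddMonoidHom.ext fun a => by
        change Additive.ofMul (ClassGroup.mulEquiv (AmbiguousClass.intAut (σ * τ)) (Additive.toMul a)) =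
          Additive.ofMul (ClassGroup.mulEquiv (AmbiguousClass.intAut σ)
            (Additive.toMul (Additive.ofMul (ClassGroup.mulEquiv (AmbiguousClass.intAut τ) (Additive.toMul a)))))
        rw [AmbiguousClass.mulEquiv_intAut_mul, MulEquiv.trans_apply, toMul_ofMul] }
  have hρ : ∀ (σ : K ≃ₐ[F] K) (a : Additive (ClassGroup (𝓞 K))),
      ρ σ a = Additive.ofMul (ClassGroup.mulEquiv (AmbiguousClass.intAut σ) (Additive.toMul a)) := fun _ _ => rfl
  have hpH : ¬ p ∣ Fintype.card H := fun h =>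
    hpH' (h.trans (by simpa [← Nat.card_eq_fintype_card] using Subgroup.card_dvd_of_le hHH'))
  -- an inverse of `#H′` in `ℤ/p`
  have hunit : IsUnit ((Fintype.card H' : ℕ) : ZMod p) := by
    rw [isUnit_iff_ne_zero, Ne, ZMod.natCast_eq_zero_iff]
    exact hpH'
  obtain ⟨w, hw⟩ := hunit
  let u : ℤ := ((w⁻¹ : (ZMod p)ˣ) : ZMod p).val
  have hu : ∀ r : ZMod p, u • (Fintype.card H' • r) = r := fun r => by
    rw [nsmul_eq_mul, zsmul_eq_mul, ← mul_assoc]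
    have h1 : ((u : ℤ) : ZMod p) * (Fintype.card H' : ZMod p) = 1 := by
      change (((((w⁻¹ : (ZMod p)ˣ) : ZMod p).val : ℕ) : ℤ) : ZMod p) * _ = 1
      rw [Int.cast_natCast, ZMod.natCast_zmod_val, ← hw, Units.inv_mul]
    rw [h1, one_mul]
  -- every `H`-invariant character is `H′`-invariant
  have hvan' : ∀ μ : Additive (ClassGroup (𝓞 K)) →+ cosetKernel H H' (ZMod p),
      (∀ (σ : K ≃ₐ[F] K) (a : Additive (ClassGroup (𝓞 K))), μ (ρ σ a) = σ • μ a) → μ = 0 :=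
    fun μ hμ => hvan μ fun σ c => by simpa [hρ] using hμ σ (Additive.ofMul c)
  have hinv := invariant_of_forall_equivariantHom_eq_zero H H' (ZMod p) (ρ) hHH' u hu hvan'
  -- so the two subtypes of invariant characters are in bijection
  let ι : {ν : Additive (ClassGroup (𝓞 K)) →+ ZMod p // ∀ h ∈ H', ∀ c : ClassGroup (𝓞 K),
        ν (Additive.ofMul (ClassGroup.mulEquiv (AmbiguousClass.intAut h) c)) = ν (Additive.ofMul c)} →
      {ν : Additive (ClassGroup (𝓞 K)) →+ ZMod p // ∀ h ∈ H, ∀ c : ClassGroup (𝓞 K),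
        ν (Additive.ofMul (ClassGroup.mulEquiv (AmbiguousClass.intAut h) c)) = ν (Additive.ofMul c)} :=
    fun ν => ⟨ν.1, fun h hh c => ν.2 h (hHH' hh) c⟩
  have hι : Function.Bijective ι := by
    refine ⟨fun ν ν' h => Subtype.ext (by simpa [ι] using congrArg Subtype.val h), fun ν => ?_⟩
    refine ⟨⟨ν.1, fun h' hh' c => ?_⟩, rfl⟩
    have h := hinv ν.1 (fun h hh a => by
      rw [hρ]
      have := ν.2 h hh (Additive.toMul a)
      rwa [ofMul_toMul] at this) h' hh' (Additive.ofMul c)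
    rwa [hρ, toMul_ofMul] at h
  rw [← natCard_invariant_eq F K H hpH, ← natCard_invariant_eq F K H' hpH']
  exact (Nat.card_eq_of_bijective ι hι).symm

end Literature.NumberTheory.NumberFields

end
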